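import Summits.CriticalPhenomena.Ising3DConformalLimit.Theorems.EnergyNotSigmaSquaredGapForcesFarMergingRootFiniteEnergyBox
import Summits.CriticalPhenomena.Ising3DConformalLimit.Theorems.EnergyNotSigmaSquaredGapForcesFarMergingRootOpacityScreen
import Literature.Probability.LatticeModels.CurrentsEdgeAvoidance

/-! # The ray event of the sourced double current: exact avoidance probability and its floor
(line `screening-form-lemma-a1` of crux `GapForcesFarMerging`, item stmt-CriticalPhenomena-4468;
helper file of stub `stub_rootOpacity`, ROOT FLOOR, the current side I)

Under `P^{0 up m,∅}_{Λ_n}` the probability that BOTH currents vanish on the lattice bonds `F` meeting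
the escape ray `R = {(0,1,t) : 0 ≤ t ≤ r}` factorises (ADC21 `P^{A,B} = P^A ⊗ P^B`,
`sourcedDoubleCurrentLaw_real_localCylinder_eq`) into the sourced and sourceless avoidance
probabilities of ADS15 (2.13)–(2.14): `⟨σ_A e^{-βK_F}⟩_{Λ_n}/⟨σ_A⟩_{Λ_n}` and `⟨e^{-βK_F}⟩_{Λ_n}`
(`sourcedAvoid_eq_div`), `A = {0}∆{up m}`. The ROOT STRAND FLOOR `⟨σ_A⟩_{Λ_n∖R} ≥ c₂(r)⟨σ_A⟩_{Λ_n}`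
(`twoPoint_up_rayHole_lower`: GKS II chain through `y' = (0,-(r+1),0)`, the segment `[y',0]` avoids `R`,
finite energy across the hole `Λ_r`), the tilt identity `⟨σ_A e^{-βK_F}⟩ = ⟨σ_A⟩_{Λ_n∖R}⟨e^{-βK_F}⟩`
(`isingExpect_free_mul_of_le`) and `e^{-βK_F} ≥ e^{-β|F|}` give a floor `p₁(r) > 0` uniform in `m > r`,
`n ≥ 2m` (`rayCylinder_real_ge`). References: Aizenman–Duminil-Copin–Sidoravicius 2015, (2.13)–(2.14);
Aizenman–Duminil-Copin 2021, §3.1 and Appendix A. -/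

noncomputable section

namespace Summit.CriticalPhenomena.Ising3DConformalLimit.EnergyNotSigmaSquaredGapForcesFarMerging

open scoped symmDiff ENNReal
open MeasureTheory Filter Finset
open Literature.Probability.LatticeModels Literature.Probability.Percolation
open Summit.CriticalPhenomena.Ising3DConformalLimit.Theorems.GapForcesFarMerging.Negative (e₁ e₂ cc2 xR up dn)
open Summit.CriticalPhenomena.Ising3DConformalLimit.GapForcesFarMergingScreening

/-! ### The strand `0 → up m` off the ray `R` -/

/-- **Root strand floor.** At `β_c(3)`, for `r ≥ 1` there is `c₂(r) > 0` such that for all `m > r` and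
`n ≥ 2m`: `c₂ ⟨σ₀σ_{up m}⟩_{Λ_n} ≤ ⟨σ₀σ_{up m}⟩_{Λ_n∖R}`, `R = {(0,1,t) : 0 ≤ t ≤ r}` (chain through
`y' = (0,-(r+1),0)`: the segment `[y',0]` avoids `R`, and `⟨σ_{y'}σ_{up m}⟩_{Λ_n∖R} ≥ ⟨σ_{y'}σ_{up m}⟩_{Λ_n∖Λ_r}
≥ C⁻¹⟨σ_{y'}σ_{up m}⟩_{Λ_n}`). [cite: AizenmanDuminilCopinAnnals2021, Appendix A, Lemma A.1] -/
theorem twoPoint_up_rayHole_lower (r : ℕ) (hr : 1 ≤ r) :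
    ∃ c₂ : ℝ, 0 < c₂ ∧ ∀ m : ℕ, r < m → ∀ n : ℕ, 2 * m ≤ n →
      c₂ * isingCorr (zdGraph 3) (box 3 n) (criticalBeta 3) 0 .free ({0} ∆ {up m}) ≤
        isingCorr (zdGraph 3) (box 3 n \ (box 3 r).filter fun x : Site 3 => x 0 = 0 ∧ x 1 = 1 ∧ 0 ≤ x 2)
          (criticalBeta 3) 0 .free ({0} ∆ {up m}) := by
  have hβ : 0 < criticalBeta 3 := criticalBeta_pos_holds (d := 3) (by norm_num)
  obtain ⟨C, hC, hFE⟩ := finiteEnergy_boxHole (d := 3) (by norm_num) hβ r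
  -- the segment `[y', 0]` on the negative `e₂`-axis and its constant
  set y' : Site 3 := Function.update (0 : Site 3) 1 (-(((r + 1 : ℕ) : ℤ))) with hy'
  set P' : Finset (Site 3) := (box 3 (r + 1)).filter fun x : Site 3 => x 0 = 0 ∧ x 2 = 0 ∧ x 1 ≤ 0 with hP'
  have hsegmem : ∀ t : ℕ, t ≤ r + 1 → Function.update y' 1 (-(((r + 1 : ℕ) : ℤ)) + t) ∈ P' := by
    intro t ht
    obtain ⟨h0, h1, h2⟩ := axisPt_coords (-(((r + 1 : ℕ) : ℤ))) (-(((r + 1 : ℕ) : ℤ)) + t)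
    rw [hP', mem_filter, mem_box_three, hy', h0, h1, h2]
    omega
  have hcseg := isingCorr_axisMove_pos (Λ' := P') hβ y' 1 (-(((r + 1 : ℕ) : ℤ))) (r + 1) hsegmem
  have hstart : Function.update y' 1 (-(((r + 1 : ℕ) : ℤ))) = y' := by
    rw [hy', Function.update_idem]
  have hend : Function.update y' 1 (-(((r + 1 : ℕ) : ℤ)) + ((r + 1 : ℕ) : ℤ)) = 0 := by
    rw [neg_add_cancel, hy', Function.update_idem]
    exact Function.update_eq_self 1 (0 : Site 3)
  rw [hstart, hend] at hcseg
  have hy'P : y' ∈ P' := by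
    have h := hsegmem 0 (Nat.zero_le _); rwa [Nat.cast_zero, add_zero, hstart] at h
  have h0P : (0 : Site 3) ∈ P' := by
    have h := hsegmem (r + 1) le_rfl; rwa [hend] at h
  obtain ⟨hy'0, hy'1, hy'2⟩ : y' 0 = 0 ∧ y' 1 = -(((r + 1 : ℕ) : ℤ)) ∧ y' 2 = 0 := by
    rw [← hstart, hy']; exact axisPt_coords _ _
  set cseg := isingCorr (zdGraph 3) P' (criticalBeta 3) 0 .free ({y'} ∆ {0}) with hcsegdef
  refine ⟨cseg * cseg * C⁻¹, by positivity, fun m hm n hn => ?_⟩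
  set R : Finset (Site 3) := (box 3 r).filter fun x : Site 3 => x 0 = 0 ∧ x 1 = 1 ∧ 0 ≤ x 2 with hR
  -- memberships
  obtain ⟨hu0, hu1, hu2⟩ := up_coords m
  have h0n : (0 : Site 3) ∈ box 3 n := zero_mem_box 3 n
  have hupn : up m ∈ box 3 n := by rw [mem_box_three, hu0, hu1, hu2]; omega
  have hupr : up m ∉ box 3 r := by rw [mem_box_three, hu0]; omega
  have hy'shell : y' ∈ box 3 (r + 1) \ box 3 r := by
    rw [Finset.mem_sdiff, mem_box_three, mem_box_three, hy'0, hy'1, hy'2]; omega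
  have hy'n : y' ∈ box 3 n := by rw [mem_box_three, hy'0, hy'1, hy'2]; omega
  have hRr : R ⊆ box 3 r := Finset.filter_subset _ _
  have hP'sub : P' ⊆ box 3 n \ R := fun x hx => by
    rw [hP', mem_filter, mem_box_three] at hx
    rw [Finset.mem_sdiff, mem_box_three, hR, mem_filter]
    push_cast at hx
    exact ⟨by omega, fun h => by omega⟩
  have hP'n : P' ⊆ box 3 n := hP'sub.trans Finset.sdiff_subset
  have hboxsub : box 3 n \ box 3 r ⊆ box 3 n \ R := Finset.sdiff_subset_sdiff le_rfl hRr
  have h0R : (0 : Site 3) ∈ box 3 n \ R := hP'sub h0P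
  have hy'R : y' ∈ box 3 n \ R := hP'sub hy'P
  have hupR : up m ∈ box 3 n \ R := hboxsub (Finset.mem_sdiff.2 ⟨hupn, hupr⟩)
  -- the pieces
  have h1 : cseg ≤ isingCorr (zdGraph 3) (box 3 n \ R) (criticalBeta 3) 0 .free ({y'} ∆ {0}) :=
    isingCorr_free_le_of_subset _ hβ.le le_rfl (pair_symmDiff_subset hy'P h0P) hP'sub
  have h1' : cseg ≤ isingCorr (zdGraph 3) (box 3 n) (criticalBeta 3) 0 .free ({y'} ∆ {0}) :=
    isingCorr_free_le_of_subset _ hβ.le le_rfl (pair_symmDiff_subset hy'P h0P) hP'n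
  have h2 : C⁻¹ * isingCorr (zdGraph 3) (box 3 n) (criticalBeta 3) 0 .free ({y'} ∆ {up m}) ≤
      isingCorr (zdGraph 3) (box 3 n \ box 3 r) (criticalBeta 3) 0 .free ({y'} ∆ {up m}) := by
    rw [inv_mul_le_iff₀ hC]
    exact hFE n (by omega) y' hy'shell (up m) (Finset.mem_sdiff.2 ⟨hupn, hupr⟩)
  have h3 : isingCorr (zdGraph 3) (box 3 n \ box 3 r) (criticalBeta 3) 0 .free ({y'} ∆ {up m}) ≤
      isingCorr (zdGraph 3) (box 3 n \ R) (criticalBeta 3) 0 .free ({y'} ∆ {up m}) :=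
    isingCorr_free_le_of_subset _ hβ.le le_rfl
      (pair_symmDiff_subset (Finset.mem_sdiff.2 ⟨hy'n, (Finset.mem_sdiff.1 hy'shell).2⟩)
        (Finset.mem_sdiff.2 ⟨hupn, hupr⟩)) hboxsub
  have h4 : isingCorr (zdGraph 3) (box 3 n) (criticalBeta 3) 0 .free ({y'} ∆ {0}) *
      isingCorr (zdGraph 3) (box 3 n) (criticalBeta 3) 0 .free ({0} ∆ {up m}) ≤
      isingCorr (zdGraph 3) (box 3 n) (criticalBeta 3) 0 .free ({y'} ∆ {up m}) :=
    isingCorr_pair_chain _ hy'n h0n hupn hβ.le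
  have h6 : isingCorr (zdGraph 3) (box 3 n \ R) (criticalBeta 3) 0 .free ({0} ∆ {y'}) *
      isingCorr (zdGraph 3) (box 3 n \ R) (criticalBeta 3) 0 .free ({y'} ∆ {up m}) ≤
      isingCorr (zdGraph 3) (box 3 n \ R) (criticalBeta 3) 0 .free ({0} ∆ {up m}) :=
    isingCorr_pair_chain _ h0R hy'R hupR hβ.le
  have hcseg0 : 0 ≤ cseg := hcseg.le
  have hA0 : 0 ≤ isingCorr (zdGraph 3) (box 3 n) (criticalBeta 3) 0 .free ({0} ∆ {up m}) :=
    GKSInequalities.gks_one_holds _ hβ.le le_rfl (Or.inl rfl) (pair_symmDiff_subset h0n hupn)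
  have hnn1 : 0 ≤ isingCorr (zdGraph 3) (box 3 n \ R) (criticalBeta 3) 0 .free ({0} ∆ {y'}) := by
    rw [symmDiff_comm]; exact hcseg0.trans h1
  calc cseg * cseg * C⁻¹ * isingCorr (zdGraph 3) (box 3 n) (criticalBeta 3) 0 .free ({0} ∆ {up m})
      = cseg * (C⁻¹ * (cseg * isingCorr (zdGraph 3) (box 3 n) (criticalBeta 3) 0 .free ({0} ∆ {up m}))) := by
        ring
    _ ≤ isingCorr (zdGraph 3) (box 3 n \ R) (criticalBeta 3) 0 .free ({0} ∆ {y'}) *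
          (C⁻¹ * isingCorr (zdGraph 3) (box 3 n) (criticalBeta 3) 0 .free ({y'} ∆ {up m})) := by
        refine mul_le_mul (by rw [symmDiff_comm]; exact h1)
          (mul_le_mul_of_nonneg_left ?_ (inv_nonneg.2 hC.le)) (by positivity) hnn1
        exact (mul_le_mul_of_nonneg_right h1' hA0).trans h4
    _ ≤ isingCorr (zdGraph 3) (box 3 n \ R) (criticalBeta 3) 0 .free ({0} ∆ {y'}) *
          isingCorr (zdGraph 3) (box 3 n \ R) (criticalBeta 3) 0 .free ({y'} ∆ {up m}) :=
        mul_le_mul_of_nonneg_left (h2.trans h3) hnn1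
    _ ≤ isingCorr (zdGraph 3) (box 3 n \ R) (criticalBeta 3) 0 .free ({0} ∆ {up m}) := h6
/-! ### The bonds meeting the ray -/

/-- The bonds meeting `R ⊆ Λ_r` lie inside `Λ_n` for `n ≥ r + 1`. [folklore] -/
theorem edgesTouching_subset_edgesIn_box {r n : ℕ} (hn : r + 1 ≤ n) {R : Finset (Site 3)} (hR : R ⊆ box 3 r) :
    edgesTouching (zdGraph 3) R ⊆ edgesIn (zdGraph 3) (box 3 n) := by
  intro e he
  obtain ⟨he1, x, hx, hxe⟩ := mem_edgesTouching_iff.1 he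
  rw [mem_edgesIn_iff]
  refine ⟨he1, ?_⟩
  have key : ∀ {a b : Site 3}, (zdGraph 3).Adj a b → a ∈ box 3 r → b ∈ box 3 n := by
    intro a b hab ha
    rw [mem_box] at ha ⊢
    obtain ⟨i, h | h⟩ := (zdGraph_adj_iff a b).1 hab
    · intro i'; rw [h]; by_cases hi : i' = i
      · subst hi; simp; constructor <;> linarith [(ha i').1, (ha i').2, (show (r : ℤ) + 1 ≤ n by exact_mod_cast hn)]
      · simp [hi]; constructor <;> linarith [(ha i').1, (ha i').2, (show (r : ℤ) + 1 ≤ n by exact_mod_cast hn)]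
    · intro i'
      have h' : b i' = a i' - (Pi.single i (1 : ℤ) : Site 3) i' := by rw [h]; simp
      rw [h']; by_cases hi : i' = i
      · subst hi; simp; constructor <;> linarith [(ha i').1, (ha i').2, (show (r : ℤ) + 1 ≤ n by exact_mod_cast hn)]
      · simp [hi]; constructor <;> linarith [(ha i').1, (ha i').2, (show (r : ℤ) + 1 ≤ n by exact_mod_cast hn)]
  induction e using Sym2.ind with
  | _ u w =>
    have hadj := (SimpleGraph.mem_edgeSet _).1 he1
    have hxr := hR hx
    intro y hy
    rcases Sym2.mem_iff.1 hy with rfl | rfl <;> rcases Sym2.mem_iff.1 hxe with rfl | rfl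
    · exact box_mono 3 (by omega) hxr
    · exact key hadj.symm hxr
    · exact key hadj hxr
    · exact box_mono 3 (by omega) hxr

/-- On the cylinder "no bond of `F = ℰ^b(R)` is open", every pair through a site of `R` is closed in the
trace (the trace consists of lattice bonds). [folklore] -/
theorem ray_closed_of_cylinder {n : ℕ} {R : Finset (Site 3)}
    {p : Current (freeBoxGraph 3 n) × Current (freeBoxGraph 3 n)}
    (hp : ∀ e ∈ edgesTouching (zdGraph 3) R, e ∉ sourcedTrace 3 n p) :
    ∀ x ∈ R, ∀ z : Site 3, s(x, z) ∉ sourcedTrace 3 n p := by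
  intro x hx z hxz
  have he : s(x, z) ∈ (zdGraph 3).edgeSet := sourcedTrace_subset_edgeSet 3 n p hxz
  exact hp _ (mem_edgesTouching_iff.2 ⟨he, x, hx, Sym2.mem_mk_left x z⟩) hxz

/-! ### `e^{-βK_F} ≥ e^{-β|F|}` -/

/-- `⟨σ_∅ e^{-βK_F}⟩ = ⟨e^{-βK_F}⟩ ≥ e^{-β|F|}` (`β ≥ 0`). [folklore] -/
theorem exp_neg_le_isingExpect_expNegBonds {β : ℝ} (hβ : 0 ≤ β) (Λ : Finset (Site 3))
    (F : Finset (Sym2 (Site 3))) :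
    Real.exp (-(β * #F)) ≤ isingExpect (zdGraph 3) Λ β 0 .free (fun σ => spinProduct ∅ σ * expNegBonds 3 β F σ) := by
  have hfun : (fun σ => spinProduct (∅ : Finset (Site 3)) σ * expNegBonds 3 β F σ) = expNegBonds 3 β F := by
    funext σ; simp [spinProduct]
  rw [hfun]
  refine le_isingExpect_of_forall_le _ Λ β 0 (measurable_expNegBonds 3 β F) fun σ => ?_
  unfold expNegBonds
  refine Real.exp_le_exp.2 ?_
  rw [neg_mul, neg_le_neg_iff]
  refine mul_le_mul_of_nonneg_left ?_ hβ
  calc ∑ e ∈ F, bondSpin σ e ≤ ∑ _e ∈ F, (1 : ℝ) :=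
        Finset.sum_le_sum fun e _ => by
          rcases bondSpin_eq_one_or σ e with h | h
          · rw [h]
          · rw [h]; norm_num
    _ = #F := by rw [sum_const, nsmul_eq_mul, mul_one]

/-! ### The tilt identity and the sourced avoidance floor -/

/-- **The sourced avoidance ratio is bounded below**: at `β_c(3)`, for `r ≥ 1` there is `c₃(r) > 0` with
`⟨σ_A e^{-βK_F}⟩_{Λ_n}/⟨σ_A⟩_{Λ_n} ≥ c₃` for `A = {0}∆{up m}`, `F` the bonds meeting the ray `R`, all
`m > r`, `n ≥ 2m` (tilt identity `⟨σ_A e^{-βK_F}⟩_{Λ_n} = ⟨σ_A⟩_{Λ_n∖R}·⟨e^{-βK_F}⟩_{Λ_n}`, the root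
strand floor and `e^{-βK_F} ≥ e^{-β|F|}`). [cite: AizenmanDuminilCopinSidoraviciusCMP2015, §2.2, eqs. (2.13)–(2.14)] -/
theorem sourcedAvoid_ray_ge (r : ℕ) (hr : 1 ≤ r) :
    ∃ c₃ : ℝ, 0 < c₃ ∧ ∀ m : ℕ, r < m → ∀ n : ℕ, 2 * m ≤ n →
      c₃ * isingCorr (zdGraph 3) (box 3 n) (criticalBeta 3) 0 .free ({0} ∆ {up m}) ≤
        isingExpect (zdGraph 3) (box 3 n) (criticalBeta 3) 0 .free (fun σ => spinProduct ({0} ∆ {up m}) σ *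
          expNegBonds 3 (criticalBeta 3)
            (edgesTouching (zdGraph 3) ((box 3 r).filter fun x : Site 3 => x 0 = 0 ∧ x 1 = 1 ∧ 0 ≤ x 2)) σ) := by
  classical
  have hβ : 0 < criticalBeta 3 := criticalBeta_pos_holds (d := 3) (by norm_num)
  obtain ⟨c₂, hc₂, hup⟩ := twoPoint_up_rayHole_lower r hr
  set R : Finset (Site 3) := (box 3 r).filter fun x : Site 3 => x 0 = 0 ∧ x 1 = 1 ∧ 0 ≤ x 2 with hR
  set F := edgesTouching (zdGraph 3) R with hF
  refine ⟨c₂ * Real.exp (-(criticalBeta 3 * #F)), by positivity, fun m hm n hn => ?_⟩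
  set β := criticalBeta 3 with hβdef
  set A : Finset (Site 3) := {0} ∆ {up m} with hA
  have hRr : R ⊆ box 3 r := Finset.filter_subset _ _
  have hFn : F ⊆ edgesIn (zdGraph 3) (box 3 n) := edgesTouching_subset_edgesIn_box (by omega) hRr
  -- the ray-hole graph
  let G₁ : SimpleGraph (Site 3) :=
    { Adj := fun x y => (zdGraph 3).Adj x y ∧ x ∉ R ∧ y ∉ R
      symm := ⟨fun x y hxy => ⟨hxy.1.symm, hxy.2.2, hxy.2.1⟩⟩
      loopless := ⟨fun x hx => (zdGraph 3).irrefl hx.1⟩ }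
  haveI : G₁.LocallyFinite := fun v =>
    Fintype.ofFinset (((zdGraph 3).neighborFinset v).filter fun w => v ∉ R ∧ w ∉ R) fun w => by
      simp [G₁, SimpleGraph.mem_neighborSet]
  have hG₁ : ∀ x y, G₁.Adj x y ↔ (zdGraph 3).Adj x y ∧ x ∉ R ∧ y ∉ R := fun _ _ => Iff.rfl
  have hle : G₁ ≤ zdGraph 3 := fun x y hxy => hxy.1
  -- the deleted edges are the bonds meeting the ray
  have hD : edgesIn (zdGraph 3) (box 3 n) \ edgesIn G₁ (box 3 n) = F := by
    ext e
    rw [Finset.mem_sdiff, mem_edgesIn_iff, mem_edgesIn_iff]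
    constructor
    · rintro ⟨⟨he1, he2⟩, he3⟩
      rw [hF, mem_edgesTouching_iff]
      refine ⟨he1, ?_⟩
      by_contra hno
      push Not at hno
      apply he3
      refine ⟨?_, he2⟩
      induction e using Sym2.ind with
      | _ u w =>
        rw [SimpleGraph.mem_edgeSet]
        exact ⟨(SimpleGraph.mem_edgeSet _).1 he1, fun h => hno u h (Sym2.mem_mk_left u w),
          fun h => hno w h (Sym2.mem_mk_right u w)⟩
    · intro he
      have he' := mem_edgesIn_iff.1 (hFn he)
      refine ⟨he', fun ⟨h1, _⟩ => ?_⟩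
      obtain ⟨-, x, hx, hxe⟩ := mem_edgesTouching_iff.1 he
      induction e using Sym2.ind with
      | _ u w =>
        have h := (SimpleGraph.mem_edgeSet G₁).1 h1
        rcases Sym2.mem_iff.1 hxe with rfl | rfl
        · exact h.2.1 hx
        · exact h.2.2 hx
  -- `W · e^{-βK_F} = 1`
  have hWneg : ∀ σ : SpinConfig (Site 3),
      (∏ e ∈ edgesIn (zdGraph 3) (box 3 n) \ edgesIn G₁ (box 3 n), Real.exp (β * bondSpin σ e)) *
        expNegBonds 3 β F σ = 1 := fun σ => by
    rw [hD, expNegBonds, ← Real.exp_sum, ← Real.exp_add, neg_mul, Finset.mul_sum, add_neg_cancel, Real.exp_zero]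
  have hmeasA : Measurable fun σ : SpinConfig (Site 3) => spinProduct A σ * expNegBonds 3 β F σ :=
    (measurable_spinProduct A).mul (measurable_expNegBonds 3 β F)
  -- tilt identities
  have h1 := isingExpect_free_mul_of_le hle (box 3 n) β 0 hmeasA
  have h2 := isingExpect_free_mul_of_le hle (box 3 n) β 0 (measurable_expNegBonds 3 β F)
  have hf1 : (fun σ : SpinConfig (Site 3) => spinProduct A σ * expNegBonds 3 β F σ *
      ∏ e ∈ edgesIn (zdGraph 3) (box 3 n) \ edgesIn G₁ (box 3 n), Real.exp (β * bondSpin σ e)) = spinProduct A := by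
    funext σ; rw [mul_assoc, mul_comm (expNegBonds 3 β F σ), hWneg, mul_one]
  have hf2 : (fun σ : SpinConfig (Site 3) => expNegBonds 3 β F σ *
      ∏ e ∈ edgesIn (zdGraph 3) (box 3 n) \ edgesIn G₁ (box 3 n), Real.exp (β * bondSpin σ e)) = fun _ => 1 := by
    funext σ; rw [mul_comm, hWneg]
  rw [hf1] at h1
  rw [hf2, isingExpect_const] at h2
  change _ * _ = isingCorr G₁ (box 3 n) β 0 .free A at h1
  set Wexp := isingExpect G₁ (box 3 n) β 0 .free
    (fun σ => ∏ e ∈ edgesIn (zdGraph 3) (box 3 n) \ edgesIn G₁ (box 3 n), Real.exp (β * bondSpin σ e)) with hWexp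
  have hWpos : 0 < Wexp := isingExpect_pos G₁ (box 3 n) β 0 .free
    (Finset.measurable_prod _ fun e _ => Real.measurable_exp.comp ((measurable_bondSpin e).const_mul β))
    fun σ => Finset.prod_pos fun e _ => Real.exp_pos _
  -- `⟨σ_A e^{-βK}⟩ = ⟨σ_A⟩_{G₁} ⟨e^{-βK}⟩`
  have hkey : isingExpect (zdGraph 3) (box 3 n) β 0 .free (fun σ => spinProduct A σ * expNegBonds 3 β F σ) =
      isingCorr G₁ (box 3 n) β 0 .free A * isingExpect (zdGraph 3) (box 3 n) β 0 .free (expNegBonds 3 β F) := by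
    have e1 : isingExpect (zdGraph 3) (box 3 n) β 0 .free (fun σ => spinProduct A σ * expNegBonds 3 β F σ) =
        isingCorr G₁ (box 3 n) β 0 .free A / Wexp := by rw [eq_div_iff hWpos.ne', h1]
    have e2 : isingExpect (zdGraph 3) (box 3 n) β 0 .free (expNegBonds 3 β F) = 1 / Wexp := by
      rw [eq_div_iff hWpos.ne', h2]
    rw [e1, e2]; ring
  -- memberships for the hole lemma and the strand floor
  obtain ⟨hu0, hu1, hu2⟩ := up_coords m
  have hupn : up m ∈ box 3 n := by rw [mem_box_three, hu0, hu1, hu2]; omega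
  have h0R : (0 : Site 3) ∉ R := fun h => by
    have := (Finset.mem_filter.1 h).2.2.1; simp at this
  have hupR : up m ∉ R := fun h => by
    have := (Finset.mem_filter.1 h).1; rw [mem_box_three, hu0] at this; omega
  have hAsub : A ⊆ box 3 n \ R := fun x hx => by
    rcases Finset.mem_symmDiff.1 hx with ⟨h, -⟩ | ⟨h, -⟩
    · rw [Finset.mem_singleton.1 h]; exact Finset.mem_sdiff.2 ⟨zero_mem_box 3 n, h0R⟩
    · rw [Finset.mem_singleton.1 h]; exact Finset.mem_sdiff.2 ⟨hupn, hupR⟩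
  rw [hkey, isingCorr_holeGraph_eq hG₁ hAsub]
  have hlow := hup m hm n hn
  have hexp := exp_neg_le_isingExpect_expNegBonds hβ.le (box 3 n) F
  have hfun : (fun σ => spinProduct (∅ : Finset (Site 3)) σ * expNegBonds 3 β F σ) = expNegBonds 3 β F := by
    funext σ; simp [spinProduct]
  rw [hfun] at hexp
  have hA0 : 0 ≤ isingCorr (zdGraph 3) (box 3 n) β 0 .free A :=
    GKSInequalities.gks_one_holds _ hβ.le le_rfl (Or.inl rfl) (symmDiff_singleton_subset_box 3 (zero_mem_box 3 n) hupn)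
  calc c₂ * Real.exp (-(β * #F)) * isingCorr (zdGraph 3) (box 3 n) β 0 .free A
      = (c₂ * isingCorr (zdGraph 3) (box 3 n) β 0 .free A) * Real.exp (-(β * #F)) := by ring
    _ ≤ isingCorr (zdGraph 3) (box 3 n \ R) β 0 .free A * isingExpect (zdGraph 3) (box 3 n) β 0 .free (expNegBonds 3 β F) :=
        mul_le_mul hlow hexp (Real.exp_pos _).le ((mul_nonneg hc₂.le hA0).trans hlow)

/-! ### The ray cylinder under the sourced double current -/

/-- **The ray cylinder probability is bounded below**: at `β_c(3)`, for `r ≥ 1` there is `p₁(r) > 0`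
such that for all `m > r`, `n ≥ 2m`, the `P^{{0}∆{up m},∅}_{Λ_n}`-probability (on pairs of box currents)
that no bond meeting the ray `R` is open is at least `p₁` (factorisation into the sourced and the
sourceless avoidance probabilities, each bounded below). [cite: AizenmanDuminilCopinAnnals2021, §3.1] -/
theorem rayCylinder_real_ge (r : ℕ) (hr : 1 ≤ r) :
    ∃ p₁ : ℝ, 0 < p₁ ∧ ∀ m : ℕ, r < m → ∀ n : ℕ, 2 * m ≤ n →
      p₁ ≤ (doubleCurrentMeasure (freeBoxGraph 3 n) (criticalBeta 3) (boxSources 3 n ({0} ∆ {up m})) ∅).real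
        {p | ∀ e ∈ edgesTouching (zdGraph 3) ((box 3 r).filter fun x : Site 3 => x 0 = 0 ∧ x 1 = 1 ∧ 0 ≤ x 2),
          e ∉ sourcedTrace 3 n p} := by
  classical
  have hβ : 0 < criticalBeta 3 := criticalBeta_pos_holds (d := 3) (by norm_num)
  obtain ⟨c₃, hc₃, havoid⟩ := sourcedAvoid_ray_ge r hr
  set R : Finset (Site 3) := (box 3 r).filter fun x : Site 3 => x 0 = 0 ∧ x 1 = 1 ∧ 0 ≤ x 2 with hR
  set F := edgesTouching (zdGraph 3) R with hF
  refine ⟨c₃ * Real.exp (-(criticalBeta 3 * #F)), by positivity, fun m hm n hn => ?_⟩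
  set β := criticalBeta 3 with hβdef
  set A : Finset (Site 3) := {0} ∆ {up m} with hA
  obtain ⟨hu0, hu1, hu2⟩ := up_coords m
  have hupn : up m ∈ box 3 n := by rw [mem_box_three, hu0, hu1, hu2]; omega
  have hAn : A ⊆ box 3 n := symmDiff_singleton_subset_box 3 (zero_mem_box 3 n) hupn
  have hne : (0 : Site 3) ≠ up m := fun h => by have := congr_fun h 0; rw [hu0] at this; simp at this; omega
  have hAeven : Even #A := by rw [hA, card_pair_symmDiff hne]; exact even_two
  have hRr : R ⊆ box 3 r := Finset.filter_subset _ _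
  have hFn : F ⊆ edgesIn (zdGraph 3) (box 3 n) := edgesTouching_subset_edgesIn_box (by omega) hRr
  have hZA : currentSum (freeBoxGraph 3 n) β (boxSources 3 n A) ≠ 0 := (currentSum_boxSources_pos 3 hβ hAn hAeven).ne'
  have hZB : currentSum (freeBoxGraph 3 n) β (boxSources 3 n (∅ : Finset (Site 3))) ≠ 0 := by
    rw [boxSources_empty]; exact (currentSum_empty_pos' _ β).ne'
  -- the event is the pull-back of the cylinder `{ω ∩ F = ∅}`
  have hevent : {p : Current (freeBoxGraph 3 n) × Current (freeBoxGraph 3 n) | ∀ e ∈ F, e ∉ sourcedTrace 3 n p} =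
      sourcedTrace 3 n ⁻¹' localCylinder (↑F : Set (Sym2 (Site 3))) ↑(∅ : Finset (Sym2 (Site 3))) := by
    ext p
    simp only [Set.mem_setOf_eq, Set.mem_preimage, localCylinder, Finset.coe_empty, Set.mem_empty_iff_false,
      iff_false, Finset.mem_coe]
  have hP : (doubleCurrentMeasure (freeBoxGraph 3 n) β (boxSources 3 n A) ∅).real
      {p | ∀ e ∈ F, e ∉ sourcedTrace 3 n p} =
      (sourcedDoubleCurrentLaw 3 n β A ∅).real (localCylinder (↑F : Set (Sym2 (Site 3))) ↑(∅ : Finset (Sym2 (Site 3)))) := by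
    rw [hevent, measureReal_def, measureReal_def,
      sourcedDoubleCurrentLaw_apply n β A ∅ (measurableSet_localCylinder_coe 3 F _), boxSources_empty]
  rw [hP, sourcedDoubleCurrentLaw_real_localCylinder_eq 3 n hβ.le hZA hZB (Finset.empty_subset F)]
  simp only [Finset.powerset_empty, Finset.sum_singleton, Finset.union_empty, if_true]
  rw [sourcedTrace_eq_sum 3 n β A (Finset.empty_subset F), sourcedTrace_eq_sum 3 n β ∅ (Finset.empty_subset F)]
  simp only [Finset.powerset_empty, Finset.sum_singleton, Finset.card_empty, pow_zero, one_mul,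
    Finset.sdiff_empty, Finset.union_empty]
  rw [sourcedAvoid_eq_div 3 n β hFn hAn, sourcedAvoid_eq_div 3 n β hFn (Finset.empty_subset _), isingCorr_empty, div_one]
  -- the two factors
  have hApos : 0 < isingCorr (zdGraph 3) (box 3 n) β 0 .free A := isingCorr_free_box_pos 3 hβ hAn hAeven
  have hfac1 : c₃ ≤ isingExpect (zdGraph 3) (box 3 n) β 0 .free (fun σ => spinProduct A σ * expNegBonds 3 β F σ) /
      isingCorr (zdGraph 3) (box 3 n) β 0 .free A := by
    rw [le_div_iff₀ hApos]; exact havoid m hm n hn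
  have hfac2 := exp_neg_le_isingExpect_expNegBonds hβ.le (box 3 n) F
  exact mul_le_mul hfac1 hfac2 (Real.exp_pos _).le (hc₃.le.trans hfac1)

/-- **The ray cylinder probability is bounded below** (registered form of `rayCylinder_real_ge`). [cite: AizenmanDuminilCopinAnnals2021, §3.1] -/
theorem rayCylinderFloor : ∀ r : ℕ, 1 ≤ r → ∃ p₁ : ℝ, 0 < p₁ ∧ ∀ m : ℕ, r < m → ∀ n : ℕ, 2 * m ≤ n → p₁ ≤ (doubleCurrentMeasure (freeBoxGraph 3 n) (criticalBeta 3) (boxSources 3 n ({0} ∆ {up m})) ∅).real {p | ∀ e ∈ edgesTouching (zdGraph 3) ((box 3 r).filter fun x : Site 3 => x 0 = 0 ∧ x 1 = 1 ∧ 0 ≤ x 2), e ∉ sourcedTrace 3 n p} :=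
  rayCylinder_real_ge

end Summit.CriticalPhenomena.Ising3DConformalLimit.EnergyNotSigmaSquaredGapForcesFarMerging

end
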